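import Summits.AtomisticToContinuum.HydrodynamicLimit.Theses.OneFlightGossipEngine
import Summits.AtomisticToContinuum.HydrodynamicLimit.Theorems.KineticCurrentsWindowLDUniform.Negative.LoadBearing
import Summits.AtomisticToContinuum.HydrodynamicLimit.Theorems.HydroLimitInBand.Negative.KineticInputSigmaZero
import HarnessLib

/-!
# `KineticCurrentsLDAlongFamilies` (crux stmt-AtomisticToContinuum-16659) — the SCALAR rows `F ⊥ 1`, `F ⊥ |v|²` are
# load-bearing: the kinetic energy is not averaged by any window

Standing disprover's lemma (`Cruxes/KineticCurrentsLDAlongFamilies/Disproof.lean` §(a);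
refuter-cdisprove-stmt-AtomisticToContinuum-16659-0, cycle 1). Inside the crux's class
`F = A(x):w⊗w + (b(x)·w) G(x,|w|²)` the two scalar orthogonality rows `F ⊥ 1`, `F ⊥ |v|²` are, given the momentum row,
the single condition `tr A(x) = 0` (rung disprover's `Negative/OrthRedundant.lean`). Deleting BOTH (momentum row kept)
admits the isotropic current `F = |v|²/3` (`A = I/3`, `b = 0`; `⊥ v_j` by oddness, growth `≤ 1 + |v|²`), whose particle
sum is `2E/3`, CONSERVED along every hard-sphere flow. By the zero-drift instance of the rung disprover's Donsker–Varadhan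
bound (`KineticCurrentsWindowTilt.tilt_window_lower_bound`: Jensen under the flow-invariant global Gibbs law, Fubini in
time) the window functional obeys, for EVERY `0 < σ ≤ 1/2`, `N`, flow `Φ` and window `w > 0`,
`∫ exp(β Σᵢ w⁻¹∫₀ʷ |vᵢ(r)|²/3 dr) dG_N ≥ e^{(N+1)β}` (`exp_le_lintegral_exp_energy_window`), which beats `e^{ε(N+1)}` at
`ε = β₀/2`, `β = β₀`, whatever `β₀ > 0`, `τ₀`, `N₀` are offered:

* `KineticCurrentsLDAlongFamiliesWithoutOrthScalars` — the crux VERBATIM (family typing) with the two scalar rows deleted,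
  a FALSE proposition, not a citable fact — and **`not_kineticCurrentsLDAlongFamiliesWithoutOrthScalars`**.

With `Negative/Inherited.lean` (`∃N₀`, `∃β₀`, `⊥v_j` load-bearing, inherited from the rung) and the tree's
`HydroLimitInBandNegative.kineticCurrentsWindowLDFamily_false_with_sigma_zero` (`0 < σ`), the load-bearing table of the
family crux is: collisions, `N ≥ N₀`, small `β`, `tr A = 0`, `b·∫w₁²G M = 0` — all necessary; `⊥ |v|²` alone redundant.
No Theses declaration is asserted positively.
-/

noncomputable section

namespace Summit.AtomisticToContinuum.HydrodynamicLimit.Theorems.KineticCurrentsLDAlongFamiliesNegative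

open MeasureTheory ProbabilityTheory Real
open scoped ENNReal
open Literature.MathematicalPhysics.KineticTheory Literature.Analysis.FluidPDE
open KineticCurrentsWindowLDUniformOneSphere (alexFlow)
open KineticCurrentsWindowLDUniformLoadBearing (sigmaOf sigmaOf_spec guard_sigmaOf)
open KineticCurrentsWindowTilt (tilt_window_lower_bound window_sum_const_mul)
open HydroLimitInBandNegative (integral_mul_localMaxwellian_eq_pi)

/-! ## §1 The isotropic current `|v|²/3` in the kinetic class -/

/-- The coefficient matrix `A = I/3`. -/
def Athird : Fin 3 → Fin 3 → ℝ := fun j k => if j = k then 3⁻¹ else 0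

/-- The crux functional at `A = I/3`, `b = 0`, `G = 0`, `u₀ = 0` is `|v|²/3` (beta-normal form after instantiation).
[folklore] -/
theorem energy_eq (v : V3) :
    (∑ j : Fin 3, ∑ k : Fin 3, Athird j k * ((v - 0) j * (v - 0) k)) + (∑ j : Fin 3, (0 : V3) j * (v - 0) j) * (0 : ℝ) =
      3⁻¹ * ‖v‖ ^ 2 := by
  simp [Athird, Fin.sum_univ_three, norm_sq_eq_sum_sq]
  ring

/-- Growth: `|‖v‖²/3| ≤ 1 + |v|²`. [folklore] -/
theorem abs_energy_le (v : V3) : |3⁻¹ * ‖v‖ ^ 2| ≤ 1 * (1 + ‖v‖ ^ 2) := by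
  rw [abs_of_nonneg (by positivity), one_mul]
  nlinarith [sq_nonneg ‖v‖]

/-- `|v|²/3 ⊥ v_j` under the unit Maxwellian (odd moments `E[W_l² W_j] = 0`). [folklore] -/
theorem norm_sq_orth_vel (j : Fin 3) : ∫ v, 3⁻¹ * ‖v‖ ^ 2 * v j * localMaxwellian 1 1 (0 : V3) v = 0 := by
  classical
  rw [integral_mul_localMaxwellian_eq_pi (g := fun v => 3⁻¹ * ‖v‖ ^ 2 * v j) (by fun_prop)]
  simp only [norm_sq_eq_sum_sq]
  have hpt : ∀ x : Fin 3 → ℝ, 3⁻¹ * (∑ l, (x l) ^ 2) * x j = ∑ l, 3⁻¹ * ((x l) ^ 2 * (x j) ^ 1) := by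
    intro x; rw [Finset.mul_sum, Finset.sum_mul]; refine Finset.sum_congr rfl fun l _ => by ring
  simp_rw [hpt]
  rw [integral_finsetSum _ fun l _ => (integrable_coord_pow_mul_coord_pow_pi l j 2 1).const_mul _]
  simp_rw [integral_const_mul, integral_coord_sq_mul_coord_pi, mul_zero, Finset.sum_const_zero]

/-! ## §2 The window functional of the kinetic energy: Jensen at zero drift, every flow -/

/-- **`∫ exp(β Σᵢ w⁻¹∫₀ʷ |vᵢ(r)|²/3 dr) dG_N ≥ e^{(N+1)β}`** for every `0 < σ ≤ 1/2`, `N`, hard-sphere flow `Φ`, window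
`w > 0` and `β ∈ ℝ`: the zero-drift instance of `tilt_window_lower_bound` (Jensen under the flow-invariant global Gibbs
law; `E_γ |W|²/3 = 1`). The conserved kinetic energy is not averaged by the window. [folklore] -/
theorem exp_le_lintegral_exp_energy_window {σ : ℝ} (hσ2 : σ ≤ 1 / 2) {N : ℕ}
    (Φ : HardSphereFlow (Torus.geometry (Fin 3)) (hsDiameter σ N) (N + 1)) {w : ℝ} (hw : 0 < w) (β : ℝ) :
    ENNReal.ofReal (Real.exp (((N : ℝ) + 1) * β)) ≤
      ∫⁻ z, ENNReal.ofReal (Real.exp (β * ∑ i, w⁻¹ * ∫ r in (0 : ℝ)..w, 3⁻¹ * ‖((Φ.flow r z) i).2‖ ^ 2))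
        ∂(localGibbsLaw σ (fun _ => 1) (fun _ => 0) (fun _ => 1) N Φ) := by
  have hC : ∀ v : V3, |β * (3⁻¹ * ‖v‖ ^ 2)| ≤ |β| * (1 + ‖v‖ ^ 2) ^ 1 := by
    intro v
    rw [pow_one, abs_mul]
    exact mul_le_mul_of_nonneg_left (by simpa using abs_energy_le v) (abs_nonneg β)
  have hkey := tilt_window_lower_bound hσ2 Φ (0 : V3) hw (g := fun v => β * (3⁻¹ * ‖v‖ ^ 2)) (by fun_prop) hC
  have hmean : ∫ v, β * (3⁻¹ * ‖v‖ ^ 2) ∂gaussMeasure (0 : V3) 1 = β := by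
    rw [integral_const_mul, integral_const_mul, CorrectorPressureDecayNegative.gaussMeasure_zero_one,
      integral_norm_sq_stdGaussian, Fintype.card_fin]
    push_cast
    ring
  rw [hmean, norm_zero] at hkey
  simp_rw [window_sum_const_mul Φ w β (fun v : V3 => 3⁻¹ * ‖v‖ ^ 2)] at hkey
  have hexp : ((N : ℝ) + 1) * (β - (0 : ℝ) ^ 2 / 2) = ((N : ℝ) + 1) * β := by ring
  rw [hexp] at hkey
  exact hkey

/-! ## §3 The crux WITHOUT the two scalar rows is FALSE -/

/-- **A FALSE proposition — NOT a citable fact.** The crux `OneFlightGossipEngine.KineticCurrentsLDAlongFamilies`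
(stmt-AtomisticToContinuum-16659) VERBATIM with the two scalar orthogonality rows
`∀ s ∈ [0,t₁] ∀ x, ∫ F_s(x,v) M dv = 0` and `∀ s ∈ [0,t₁] ∀ x, ∫ F_s(x,v) |v|² M dv = 0` DELETED (momentum row kept);
kept only as the statement that `not_kineticCurrentsLDAlongFamiliesWithoutOrthScalars` negates. -/
def KineticCurrentsLDAlongFamiliesWithoutOrthScalars : Prop :=
  ∃ η₀ : ℝ, 0 < η₀ ∧ ∀ (t₁ : ℝ) (a θ₀ : ℝ → T3 → ℝ) (u₀ : ℝ → T3 → V3),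
    Continuous (Function.uncurry a) → Continuous (Function.uncurry θ₀) → Continuous (Function.uncurry u₀) →
    (∀ s x, 0 < a s x) → (∀ s x, 0 < θ₀ s x) →
    ∀ σ : ℝ, 0 < σ → (∀ s ∈ Set.Icc 0 t₁, σ ^ 3 * (⨆ x, a s x) ≤ η₀ * ∫ x, a s x) →
    ∀ Φ : (N : ℕ) → HardSphereFlow (Torus.geometry (Fin 3)) (hsDiameter σ N) (N + 1),
    ∀ (A : ℝ → T3 → Fin 3 → Fin 3 → ℝ) (b : ℝ → T3 → V3) (G : ℝ → T3 × ℝ → ℝ),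
    Continuous (Function.uncurry A) → Continuous (Function.uncurry b) → Continuous (Function.uncurry G) →
    (let F := fun (s : ℝ) (y : T3 × V3) =>
       (∑ j : Fin 3, ∑ k : Fin 3, A s y.1 j k * ((y.2 - u₀ s y.1) j * (y.2 - u₀ s y.1) k)) +
         (∑ j : Fin 3, b s y.1 j * (y.2 - u₀ s y.1) j) * G s (y.1, ‖y.2 - u₀ s y.1‖ ^ 2)
     (∃ C : ℝ, ∀ s ∈ Set.Icc 0 t₁, ∀ y : T3 × V3, |F s y| ≤ C * (1 + ‖y.2‖ ^ 2)) →
     (∀ s ∈ Set.Icc 0 t₁, ∀ x (j : Fin 3),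
        ∫ v, F s (x, v) * v j * localMaxwellian 1 (θ₀ s x) (u₀ s x) v = 0) →
     ∃ β₀ : ℝ, 0 < β₀ ∧ ∀ β : ℝ, |β| ≤ β₀ → ∀ ε : ℝ, 0 < ε → ∃ τ₀ : ℝ, 0 < τ₀ ∧ ∀ τ : ℝ, τ₀ ≤ τ →
     ∃ N₀ : ℕ, ∀ N : ℕ, N₀ ≤ N → ∀ s ∈ Set.Icc 0 t₁,
       ∫⁻ z, ENNReal.ofReal (Real.exp (β * ∑ i : Fin (N + 1),
           (τ * ((N : ℝ) + 1) ^ (-(1 / 3 : ℝ)))⁻¹ *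
             ∫ r in (0 : ℝ)..(τ * ((N : ℝ) + 1) ^ (-(1 / 3 : ℝ))), F s ((Φ N).flow r z i)))
         ∂(localGibbsLaw σ (a s) (u₀ s) (θ₀ s) N (Φ N)) ≤
       ENNReal.ofReal (Real.exp (ε * ((N : ℝ) + 1))))

/-- **THE SCALAR ROWS ARE LOAD-BEARING: `KineticCurrentsLDAlongFamiliesWithoutOrthScalars` is FALSE.** Witness: `η₀`
arbitrary, constant family (`t₁ = 0`) `a = θ₀ = 1`, `u₀ = 0`, `σ = min(1/4, η₀, 1)` (guard), Alexander flows, `A = I/3`,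
`b = 0`, `G = 0` (`F = |v|²/3`: `⊥ v_j`, growth `≤ 1 + |v|²`): given the offered `β₀ > 0` take `β = β₀`, `ε = β₀/2`;
whatever `τ₀, N₀`, at `τ = τ₀`, `N = N₀`, `s = 0` the functional is `≥ e^{(N₀+1)β₀} > e^{(N₀+1)β₀/2}`
(`exp_le_lintegral_exp_energy_window`). Reading for provers: `tr A_s(x) = 0` is used ESSENTIALLY. [folklore] -/
theorem not_kineticCurrentsLDAlongFamiliesWithoutOrthScalars : ¬ KineticCurrentsLDAlongFamiliesWithoutOrthScalars := by
  rintro ⟨η₀, hη₀, h⟩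
  obtain ⟨hσpos, hσ4, -, -⟩ := sigmaOf_spec hη₀
  have hσhalf : sigmaOf η₀ ≤ 1 / 2 := hσ4.trans (by norm_num)
  have hσhalf' : sigmaOf η₀ < 2⁻¹ := hσ4.trans_lt (by norm_num)
  have hmain := h 0 (fun _ _ => 1) (fun _ _ => 1) (fun _ _ => 0) continuous_const continuous_const continuous_const
    (fun _ _ => one_pos) (fun _ _ => one_pos) (sigmaOf η₀) hσpos (fun _ _ => guard_sigmaOf hη₀) (alexFlow hσpos hσhalf')
    (fun _ _ => Athird) (fun _ _ => 0) (fun _ _ => 0) continuous_const continuous_const continuous_const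
  dsimp only at hmain
  simp only [energy_eq] at hmain
  obtain ⟨β₀, hβ₀, hβ⟩ := hmain ⟨1, fun _ _ y => abs_energy_le y.2⟩ (fun _ _ _ j => norm_sq_orth_vel j)
  obtain ⟨τ₀, hτ₀, hτ⟩ := hβ β₀ (by rw [abs_of_pos hβ₀]) (β₀ / 2) (by positivity)
  obtain ⟨N₀, hN⟩ := hτ τ₀ le_rfl
  have h0 := hN N₀ le_rfl 0 ⟨le_rfl, le_rfl⟩
  have hw : 0 < τ₀ * ((N₀ : ℝ) + 1) ^ (-(1 / 3 : ℝ)) := mul_pos hτ₀ (Real.rpow_pos_of_pos (by positivity) _)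
  have hlow := exp_le_lintegral_exp_energy_window hσhalf (alexFlow hσpos hσhalf' N₀) hw β₀
  have hle : ENNReal.ofReal (Real.exp (((N₀ : ℝ) + 1) * β₀)) ≤
      ENNReal.ofReal (Real.exp (β₀ / 2 * ((N₀ : ℝ) + 1))) := hlow.trans h0
  rw [ENNReal.ofReal_le_ofReal_iff (Real.exp_pos _).le, Real.exp_le_exp] at hle
  have hN1 : (0 : ℝ) < (N₀ : ℝ) + 1 := by positivity
  nlinarith [hle, hβ₀, mul_pos hN1 hβ₀]

end Summit.AtomisticToContinuum.HydrodynamicLimit.Theorems.KineticCurrentsLDAlongFamiliesNegative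

end
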